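import Summits.BirchSwinnertonDyer.BirchSwinnertonDyer.Theorems.ByReductionTypeAtTwoAdditivePotGoodPrintZhaiIrreducibleCorrected
import Summits.BirchSwinnertonDyer.BirchSwinnertonDyer.Theorems.ByReductionTypeAtTwoAdditivePotGoodLowerHalfFrontierRows
import Summits.BirchSwinnertonDyer.BirchSwinnertonDyer.Theorems.EisensteinDepletionAtTwoDepletedLawCFLowerHalf
import Summits.BirchSwinnertonDyer.Rank1Residual.AdditivePotMult.RankZeroKimNakamuraIntModel
import Literature.NumberTheory.DiophantineGeometry.EllArithGlueProofs
import Literature.NumberTheory.DiophantineGeometry.MinimalDiscriminantFiniteProofs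
import Summits.BirchSwinnertonDyer.Uniform.U2.CubicFieldInertOddTrace
import Summits.BirchSwinnertonDyer.Rank1Residual.Supersingular.RationalLadder
import HarnessLib

/-!
# K4 crux `AdditiveRankZeroAtTwo` (19098), child C3″ `AdditivePotGoodLowerHalfAtTwo` (22617): the ZHAI 2016 print road at the bases
# `152B1`, `464D1` (Kodaira `I₀*` at `2`) of Cremona's Table 1 (Thm. 1.1, `Δ < 0`) — file D (`116A1 = [0,0,0,−4831,−129242]`, also eligible, is the
# tree's `AdditiveBranchIMCGordTwoRankZeroCompanion.cV2900d1` and is left out to keep the import cone small)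

Cell `bsd-2adic`, seat `bsd-2adic-k4-w2` GEN 6 (prover, explicit unit, no kit); `--supports stmt-BirchSwinnertonDyer-22617 --as helper`;
companion of `…AdditivePotGoodPrintZhaiIrreducible.lean` (the generic road `printFamilyZhai11_lower` / `printFamilyZhai12_lower`).
HONEST FRAMING (D-0036/D-0054): for each base `V` the KERNEL decides ellipticity, global minimality (Kraus–Silverman certificate), the sign
of `Δ`, `V[2]` irreducible (root-free `2`-division cubic modulo a small prime), `ord₂ j(V)` exactly (inside the window `[1, 11]`: `V` and all
its twists by `M ≡ 1 (mod 4)` are ADDITIVE and POTENTIALLY GOOD at `2`) and non-CM; DISPLAYED, exactly as Zhai's theorem takes them, are the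
`X₀(N)`-optimality datum (`Dt`, `hopt` — the bases are the FIRST curves of their classes in Cremona's 1992 Table 1, i.e. the «strong Weil
curves») and the record `ord₂(L(V,1)/Ω_∞(V)) = 0` (resp. `= 1` for `Δ > 0`), read off Cremona's Tables 1 and 4 (`r = 0`, `S = 1` for every
`N ≤ 1000` except `571A, 681B, 960D, 960N`; `L(V,1)/Ω_BSD = S·∏c_p/#T²` odd; `Ω_BSD = c_∞·Ω_∞`). The road is keyed on Zhai's CORRECTED
statements (arXiv v2: odd Manin constant; the tree's primed facts `Zhai2016.thm11_…'` / `thm12_…'`, ERRATUM file of the b2b cell), the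
Manin binder supplied BY PRINT (Agashe–Ribet–Stein 2006 Thm. 2.6, `h26`) from the KERNEL level bound `N(V) ≤ 130000`
(`N ∣ |Δ_min|`; for `196B1` sharpened by `f₇ ≤ 2`). Labels are those of the 1992 first
edition (held text `book:cremona1997-…`, Table 1 pp. for `N = 104, 116, 124, 196, 200, 540, 676`); the curves are pinned by their
a-invariants. OUTPUT per base: at EVERY global minimal `W ≅ V^{(M)}` (`M` as in Zhai's Thm. 1.1 / 1.2) the C3″ binders are decided
(`r_an(W) = 0`, `Addv W 2`, `0 ≤ ord₂ j`, `¬CM`, `Irr W 2`) and the LOWER half `MissingLowerBoundAt W 2` HOLDS. Inputs BY NAME: Zhai 2016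
Thm. 1.1 / 1.2 CORRECTED (flag-free at `2`, analytic rank zero), Agashe–Ribet–Stein Thm. 2.6, modularity. NO GZK, no reading, no instrument, no base certificate. These are the
first intrinsically-additive `E[2]`-IRREDUCIBLE print families of the K4 additive block (GEN 5's was the `C₂`-type `37a1^{(−m)}`);
disjoint from the cell's residual census (`ord₂ #Ш_an ≤ 0` here). Closes nothing at the `∀`-level; nothing booked; BSD is not proved by
any of this. References: [Zhai2016] Thms. 1.1–1.2; [CremonaAlgorithms1997] Tables 1, 4; [SilvermanAEC2009] III.1, III.2.3, VII.1, VII.5,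
App. C §11; [Kraus1989] Prop. 1–2; [Miller2011LMS] Def. 1.1.
-/

set_option autoImplicit false
-- the Theorems namespace of this sub repeats the summit name by design (D-0017 nested layout)
set_option linter.dupNamespace false

noncomputable section

open scoped Classical

open WeierstrassCurve Literature.NumberTheory.EllipticCurves
  Literature.NumberTheory.EllipticCurves.ModularForms
  Literature.NumberTheory.EllipticCurves.Rank1Residual
  Literature.NumberTheory.EllipticCurves.Rank1Residual.Typed
  Literature.NumberTheory.EllipticCurves.CoatesLiTianZhai2015
  Literature.NumberTheory.EllipticCurves.Zhai2016
  Literature.NumberTheory.EllipticCurves.AgasheRibetStein2006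
  Summit.BirchSwinnertonDyer
  Summit.BirchSwinnertonDyer.Rank1Residual
  Summit.BirchSwinnertonDyer.Rank1Residual.X11b
  Summit.BirchSwinnertonDyer.Rank1Residual.X5.O1
  Summit.BirchSwinnertonDyer.Rank1Residual.P2
  Summit.BirchSwinnertonDyer.BirchSwinnertonDyer.Rank1Residual.IntModel
  Summit.BirchSwinnertonDyer.BirchSwinnertonDyer.Theorems

namespace Summit.BirchSwinnertonDyer.BirchSwinnertonDyer.Theorems.AddPotGoodPrint

/-! ## Base `152B1` = `[0, 1, 0, -8, -16]` (Cremona 1992 Table 1: `N = 152 = 2³·19`, `r = 0`, `#T = 1`, `c_p = (1, 1)`, Kodaira `II*, I₁`;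
Table 4: `S = 1`), `Δ = -38912` (-), `j = -31250/19` (`ord₂ j = 1`), Zhai Thm. 1.1 -/
section Base152B1

/-- `152B1 = [0, 1, 0, -8, -16]` is an elliptic curve (`Δ = -38912 ≠ 0`). [cite: CremonaAlgorithms1997, Table 1] -/
theorem isElliptic_152B1 : (⟨0, 1, 0, -8, -16⟩ : WeierstrassCurve ℚ).IsElliptic := ⟨by
  rw [isUnit_iff_ne_zero]; norm_num [WeierstrassCurve.Δ, WeierstrassCurve.b₂, WeierstrassCurve.b₄, WeierstrassCurve.b₆, WeierstrassCurve.b₈]⟩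

/-- `152B1` is GLOBALLY MINIMAL (`|Δ| = 38912`: `v_p Δ < 12` at every prime; Kraus at `2`, Silverman at odd `p`).
[cite: SilvermanAEC2009, VII.1 Remark 1.1] [cite: Kraus1989, Prop. 1 and Prop. 2] -/
theorem isGloballyMinimal_152B1 : (⟨0, 1, 0, -8, -16⟩ : WeierstrassCurve ℚ).IsGloballyMinimal :=
  isGloballyMinimal_of_krausCriterion_support (0) (1) (0) (-8) (-16) [(2, 0, 11), (19, 0, 1)]
    (by intro t ht; simp only [List.mem_cons, List.not_mem_nil, or_false] at ht
        rcases ht with rfl | rfl <;> norm_num)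
    (by decide +kernel) (by decide +kernel)

/-- `Δ(152B1) = -38912` on the integer model. [cite: CremonaAlgorithms1997, Table 1] -/
theorem M152B1_Δ : (⟨0, 1, 0, -8, -16⟩ : WeierstrassCurve ℤ).Δ = -38912 := by decide +kernel
/-- `c₄(152B1) = 400` on the integer model. [cite: CremonaAlgorithms1997, Table 1] -/
theorem M152B1_c₄ : (⟨0, 1, 0, -8, -16⟩ : WeierstrassCurve ℤ).c₄ = 400 := by decide +kernel
/-- `Δ(152B1) < 0` (rational model). [cite: CremonaAlgorithms1997, Table 1] -/
theorem Δ_sign_152B1 : (⟨0, 1, 0, -8, -16⟩ : WeierstrassCurve ℚ).Δ < 0 := by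
  norm_num [WeierstrassCurve.Δ, WeierstrassCurve.b₂, WeierstrassCurve.b₄, WeierstrassCurve.b₆, WeierstrassCurve.b₈]

/-- The integer model of `152B1` is Cremona's. [cite: SilvermanAEC2009, VIII.8] -/
theorem intModel_152B1 :
    haveI := isElliptic_152B1; haveI := isGloballyMinimal_152B1
    integralModelInt (⟨0, 1, 0, -8, -16⟩ : WeierstrassCurve ℚ) = (⟨0, 1, 0, -8, -16⟩ : WeierstrassCurve ℤ) :=
  haveI := isElliptic_152B1; haveI := isGloballyMinimal_152B1
  integralModelInt_eq_of_map_eq _ (by ext <;> simp [WeierstrassCurve.map])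

/-- `b₂, b₄, b₆` of `152B1`. [cite: SilvermanAEC2009, III.1] -/
theorem b_152B1 : (⟨0, 1, 0, -8, -16⟩ : WeierstrassCurve ℚ).b₂ = ((4 : ℤ) : ℚ) ∧ (⟨0, 1, 0, -8, -16⟩ : WeierstrassCurve ℚ).b₄ = ((-16 : ℤ) : ℚ) ∧
    (⟨0, 1, 0, -8, -16⟩ : WeierstrassCurve ℚ).b₆ = ((-64 : ℤ) : ℚ) := by
  simp only [WeierstrassCurve.b₂, WeierstrassCurve.b₄, WeierstrassCurve.b₆]; norm_num

/-- **`E[2]` irreducible for `152B1`** (`E[2](ℚ) = 0`): the monic `2`-division cubic `X³ + b₂X² + 8b₄X + 16b₆` has no root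
modulo `3`. [cite: SilvermanAEC2009, III.2.3 (b)] [cite: Zhai2016, Thm. 1.1 (hypothesis E[2](ℚ) = 0)] -/
theorem irr_two_152B1 :
    haveI := isElliptic_152B1
    Irr (⟨0, 1, 0, -8, -16⟩ : WeierstrassCurve ℚ) 2 :=
  haveI := isElliptic_152B1
  irr_two_of_forall_cubic_ne _ b_152B1.1 b_152B1.2.1 b_152B1.2.2 (ℓ := 3) (by decide)

/-- **`ord₂ j(152B1) = 1`** (`2⁴ ∥ c₄ = 400`, `2^11 ∥ Δ`): inside the window `[1, 11]`, so `152B1` and every twist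
`152B1^{(M)}` are ADDITIVE and POTENTIALLY GOOD at `2`. [cite: SilvermanAEC2009, III.1 and VII.5 Prop. 5.5] -/
theorem padicValRat_j_152B1 :
    haveI := isElliptic_152B1
    padicValRat 2 (⟨0, 1, 0, -8, -16⟩ : WeierstrassCurve ℚ).j = 1 := by
  haveI : Fact (Nat.Prime 2) := ⟨Nat.prime_two⟩
  haveI := isElliptic_152B1; haveI := isGloballyMinimal_152B1
  rw [AdditivePotMult.padicValRat_j_eq_of_intModel intModel_152B1 2 4 11 (by rw [M152B1_c₄]; decide) (by rw [M152B1_c₄]; decide)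
    (by rw [M152B1_Δ]; decide) (by rw [M152B1_Δ]; decide)]
  norm_num

/-- **`N(152B1) ∣ |Δ_min| = 38912`** (the conductor divides the minimal discriminant). [cite: SilvermanAEC2009, VIII.11 and C.16] -/
theorem conductorNorm_dvd_152B1 :
    haveI := isElliptic_152B1
    (⟨0, 1, 0, -8, -16⟩ : WeierstrassCurve ℚ).conductorNorm ℤ ∣ 38912 := by
  haveI := isElliptic_152B1; haveI := isGloballyMinimal_152B1
  have hdvd := WeierstrassCurve.conductorNorm_dvd_minimalDiscriminantNorm (⟨0, 1, 0, -8, -16⟩ : WeierstrassCurve ℚ)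
    (WeierstrassCurve.finite_setOf_ordMinimalDiscriminant_ne_zero_holds _)
  rw [WeierstrassCurve.minimalDiscriminantNorm_int_eq_natAbs_minimalDiscriminantInt_holds,
    minimalDiscriminantInt_eq intModel_152B1, M152B1_Δ] at hdvd
  exact hdvd

/-- **`N(152B1) ≤ 130000`** (`N ∣ 38912`; Cremona: `N = 152`, not needed) — the level bound feeding Agashe–Ribet–Stein Thm. 2.6.
[cite: AgasheRibetStein2006, Thm. 2.6] -/
theorem conductorNorm_le_152B1 :
    haveI := isElliptic_152B1
    (⟨0, 1, 0, -8, -16⟩ : WeierstrassCurve ℚ).conductorNorm ℤ ≤ 130000 :=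
  le_trans (Nat.le_of_dvd (by norm_num) conductorNorm_dvd_152B1) (by norm_num)
/-- **`152B1` is non-CM**: `ord₂ j = 1 ∈ {1,2,5,7,8,9,10,11}` (k4-w1's window: no CM `j`-invariant has such a `2`-adic valuation). [cite: SilvermanAEC2009, App. C §11] -/
theorem not_hasCM_152B1 :
    haveI := isElliptic_152B1
    ¬ (⟨0, 1, 0, -8, -16⟩ : WeierstrassCurve ℚ).HasCM := by
  haveI : Fact (Nat.Prime 2) := ⟨Nat.prime_two⟩
  haveI := isElliptic_152B1; haveI := isGloballyMinimal_152B1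
  exact not_hasCM_of_padicValRat_two_j_mem _ (by rw [padicValRat_j_152B1]; decide)

/-- **THE ZHAI-1.1 ROAD AT THE BASE `152B1`**: for every `M` as in Zhai 2016 Thm. 1.1 (square-free,
`M ≡ 1 (mod 4)`, `(M, N) = 1`, `r ≥ 1` odd prime factors all inert in the cubic `2`-division field `F` of `152B1`) and every global
minimal `W ≅ 152B1^{(M)}`: `r_an(W) = 0`, `W` is ADDITIVE and POTENTIALLY GOOD at `2`, NON-CM, `W[2]` IRREDUCIBLE, and the LOWER
half `MissingLowerBoundAt W 2` of BSD₂ HOLDS. KERNEL: ellipticity, global minimality, `Δ < 0`, `E[2]` irreducible,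
`ord₂ j = 1`, non-CM. DISPLAYED (as printed): the `X₀(152)`-optimality datum (`Dt`, `hopt`) and the record
`ord₂(L(152B1,1)/Ω_∞) = 0` (Cremona 1992 Tables 1 and 4: L(E,1)/Ω_BSD = S·∏c_p/#T² = 1 (Δ < 0, one real component, Ω_BSD = Ω_∞): ord₂ L^alg = 0); the odd Manin constant of Zhai's corrected statement is
Agashe–Ribet–Stein Thm. 2.6 BY NAME (`h26`) at level `N ≤ 130000` (kernel `conductorNorm_le_152B1`). Inputs BY NAME: Zhai 2016
Thm. 1.1 (corrected, arXiv v2), Agashe–Ribet–Stein 2006 Thm. 2.6, modularity. No GZK, no reading, no instrument, no base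
certificate. BSD is not proved by any of this.
[cite: Zhai2016, Thm. 1.1] [cite: AgasheRibetStein2006, Thm. 2.6] [cite: CremonaAlgorithms1997, Table 1 and Table 4] [cite: Miller2011LMS, Def. 1.1] -/
theorem printFamily152B1_lower (h11 : thm11_ordTwo_LAlg_twist_eq_zero')
    (h26 : cremona_abs_maninConstant_eq_one_of_level_le) (hmod : hasEntireLFunction_rat)
    [hN : haveI := isElliptic_152B1; NeZero ((⟨0, 1, 0, -8, -16⟩ : WeierstrassCurve ℚ).conductorNorm ℤ)]
    (Dt : haveI := isElliptic_152B1; ModularParametrizationData (⟨0, 1, 0, -8, -16⟩ : WeierstrassCurve ℚ) ((⟨0, 1, 0, -8, -16⟩ : WeierstrassCurve ℚ).conductorNorm ℤ))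
    (hopt : haveI := isElliptic_152B1; Zhai2021.IsOptimalDatum (⟨0, 1, 0, -8, -16⟩ : WeierstrassCurve ℚ) Dt)
    (hL : haveI := isElliptic_152B1; ∃ x : ℚ, IsLAlg (⟨0, 1, 0, -8, -16⟩ : WeierstrassCurve ℚ) x ∧ x ≠ 0 ∧ padicValRat 2 x = 0)
    (F : Type) [Field F] [NumberField F] (hF : IsTwoDivisionField (⟨0, 1, 0, -8, -16⟩ : WeierstrassCurve ℚ) F)
    (M : ℤ) (hsq : Squarefree M) (hM4 : M % 4 = 1)
    (hgcd : haveI := isElliptic_152B1; Int.gcd M ((⟨0, 1, 0, -8, -16⟩ : WeierstrassCurve ℚ).conductorNorm ℤ) = 1)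
    (hne : M.natAbs.primeFactors.Nonempty) (hin : ∀ q ∈ M.natAbs.primeFactors, q ≠ 2 ∧ IsInertIn F q)
    (W : WeierstrassCurve ℚ) [W.IsElliptic] [W.IsGloballyMinimal]
    (hW : ∃ C : VariableChange ℚ, C • (⟨0, 1, 0, -8, -16⟩ : WeierstrassCurve ℚ).quadraticTwist (M : ℚ) = W) :
    haveI : Fact (Nat.Prime 2) := ⟨Nat.prime_two⟩
    W.analyticRank = 0 ∧ Addv W 2 ∧ 0 ≤ padicValRat 2 W.j ∧ ¬ W.HasCM ∧ Irr W 2 ∧ MissingLowerBoundAt W 2 := by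
  haveI := isElliptic_152B1; haveI := isGloballyMinimal_152B1
  exact printFamilyZhai11'_lower_of_level_le h11 h26 hmod _ conductorNorm_le_152B1 Dt hopt Δ_sign_152B1 irr_two_152B1
    (by rw [padicValRat_j_152B1]) (by rw [padicValRat_j_152B1]; norm_num) not_hasCM_152B1 hL F hF M hsq hM4
    hgcd hne hin W hW

end Base152B1

/-! ## Base `464D1` = `[0, -1, 0, -4, -4]` (Cremona 1992 Table 1: `N = 464 = 2⁴·29`, `r = 0`, `#T = 1`, `c_p = (1, 1)`, Kodaira `I₀*, I₁`;
Table 4: `S = 1`), `Δ = -7424` (-), `j = -35152/29` (`ord₂ j = 4`), Zhai Thm. 1.1 -/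
section Base464D1

/-- `464D1 = [0, -1, 0, -4, -4]` is an elliptic curve (`Δ = -7424 ≠ 0`). [cite: CremonaAlgorithms1997, Table 1] -/
theorem isElliptic_464D1 : (⟨0, -1, 0, -4, -4⟩ : WeierstrassCurve ℚ).IsElliptic := ⟨by
  rw [isUnit_iff_ne_zero]; norm_num [WeierstrassCurve.Δ, WeierstrassCurve.b₂, WeierstrassCurve.b₄, WeierstrassCurve.b₆, WeierstrassCurve.b₈]⟩

/-- `464D1` is GLOBALLY MINIMAL (`|Δ| = 7424`: `v_p Δ < 12` at every prime; Kraus at `2`, Silverman at odd `p`).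
[cite: SilvermanAEC2009, VII.1 Remark 1.1] [cite: Kraus1989, Prop. 1 and Prop. 2] -/
theorem isGloballyMinimal_464D1 : (⟨0, -1, 0, -4, -4⟩ : WeierstrassCurve ℚ).IsGloballyMinimal :=
  isGloballyMinimal_of_krausCriterion_support (0) (-1) (0) (-4) (-4) [(2, 0, 8), (29, 0, 1)]
    (by intro t ht; simp only [List.mem_cons, List.not_mem_nil, or_false] at ht
        rcases ht with rfl | rfl <;> norm_num)
    (by decide +kernel) (by decide +kernel)

/-- `Δ(464D1) = -7424` on the integer model. [cite: CremonaAlgorithms1997, Table 1] -/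
theorem M464D1_Δ : (⟨0, -1, 0, -4, -4⟩ : WeierstrassCurve ℤ).Δ = -7424 := by decide +kernel
/-- `c₄(464D1) = 208` on the integer model. [cite: CremonaAlgorithms1997, Table 1] -/
theorem M464D1_c₄ : (⟨0, -1, 0, -4, -4⟩ : WeierstrassCurve ℤ).c₄ = 208 := by decide +kernel
/-- `Δ(464D1) < 0` (rational model). [cite: CremonaAlgorithms1997, Table 1] -/
theorem Δ_sign_464D1 : (⟨0, -1, 0, -4, -4⟩ : WeierstrassCurve ℚ).Δ < 0 := by
  norm_num [WeierstrassCurve.Δ, WeierstrassCurve.b₂, WeierstrassCurve.b₄, WeierstrassCurve.b₆, WeierstrassCurve.b₈]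

/-- The integer model of `464D1` is Cremona's. [cite: SilvermanAEC2009, VIII.8] -/
theorem intModel_464D1 :
    haveI := isElliptic_464D1; haveI := isGloballyMinimal_464D1
    integralModelInt (⟨0, -1, 0, -4, -4⟩ : WeierstrassCurve ℚ) = (⟨0, -1, 0, -4, -4⟩ : WeierstrassCurve ℤ) :=
  haveI := isElliptic_464D1; haveI := isGloballyMinimal_464D1
  integralModelInt_eq_of_map_eq _ (by ext <;> simp [WeierstrassCurve.map])

/-- `b₂, b₄, b₆` of `464D1`. [cite: SilvermanAEC2009, III.1] -/
theorem b_464D1 : (⟨0, -1, 0, -4, -4⟩ : WeierstrassCurve ℚ).b₂ = ((-4 : ℤ) : ℚ) ∧ (⟨0, -1, 0, -4, -4⟩ : WeierstrassCurve ℚ).b₄ = ((-8 : ℤ) : ℚ) ∧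
    (⟨0, -1, 0, -4, -4⟩ : WeierstrassCurve ℚ).b₆ = ((-16 : ℤ) : ℚ) := by
  simp only [WeierstrassCurve.b₂, WeierstrassCurve.b₄, WeierstrassCurve.b₆]; norm_num

/-- **`E[2]` irreducible for `464D1`** (`E[2](ℚ) = 0`): the monic `2`-division cubic `X³ + b₂X² + 8b₄X + 16b₆` has no root
modulo `3`. [cite: SilvermanAEC2009, III.2.3 (b)] [cite: Zhai2016, Thm. 1.1 (hypothesis E[2](ℚ) = 0)] -/
theorem irr_two_464D1 :
    haveI := isElliptic_464D1
    Irr (⟨0, -1, 0, -4, -4⟩ : WeierstrassCurve ℚ) 2 :=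
  haveI := isElliptic_464D1
  irr_two_of_forall_cubic_ne _ b_464D1.1 b_464D1.2.1 b_464D1.2.2 (ℓ := 3) (by decide)

/-- **`ord₂ j(464D1) = 4`** (`2⁴ ∥ c₄ = 208`, `2^8 ∥ Δ`): inside the window `[1, 11]`, so `464D1` and every twist
`464D1^{(M)}` are ADDITIVE and POTENTIALLY GOOD at `2`. [cite: SilvermanAEC2009, III.1 and VII.5 Prop. 5.5] -/
theorem padicValRat_j_464D1 :
    haveI := isElliptic_464D1
    padicValRat 2 (⟨0, -1, 0, -4, -4⟩ : WeierstrassCurve ℚ).j = 4 := by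
  haveI : Fact (Nat.Prime 2) := ⟨Nat.prime_two⟩
  haveI := isElliptic_464D1; haveI := isGloballyMinimal_464D1
  rw [AdditivePotMult.padicValRat_j_eq_of_intModel intModel_464D1 2 4 8 (by rw [M464D1_c₄]; decide) (by rw [M464D1_c₄]; decide)
    (by rw [M464D1_Δ]; decide) (by rw [M464D1_Δ]; decide)]
  norm_num

/-- **`N(464D1) ∣ |Δ_min| = 7424`** (the conductor divides the minimal discriminant). [cite: SilvermanAEC2009, VIII.11 and C.16] -/
theorem conductorNorm_dvd_464D1 :
    haveI := isElliptic_464D1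
    (⟨0, -1, 0, -4, -4⟩ : WeierstrassCurve ℚ).conductorNorm ℤ ∣ 7424 := by
  haveI := isElliptic_464D1; haveI := isGloballyMinimal_464D1
  have hdvd := WeierstrassCurve.conductorNorm_dvd_minimalDiscriminantNorm (⟨0, -1, 0, -4, -4⟩ : WeierstrassCurve ℚ)
    (WeierstrassCurve.finite_setOf_ordMinimalDiscriminant_ne_zero_holds _)
  rw [WeierstrassCurve.minimalDiscriminantNorm_int_eq_natAbs_minimalDiscriminantInt_holds,
    minimalDiscriminantInt_eq intModel_464D1, M464D1_Δ] at hdvd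
  exact hdvd

/-- **`N(464D1) ≤ 130000`** (`N ∣ 7424`; Cremona: `N = 464`, not needed) — the level bound feeding Agashe–Ribet–Stein Thm. 2.6.
[cite: AgasheRibetStein2006, Thm. 2.6] -/
theorem conductorNorm_le_464D1 :
    haveI := isElliptic_464D1
    (⟨0, -1, 0, -4, -4⟩ : WeierstrassCurve ℚ).conductorNorm ℤ ≤ 130000 :=
  le_trans (Nat.le_of_dvd (by norm_num) conductorNorm_dvd_464D1) (by norm_num)
/-- **`464D1` is non-CM**: multiplicative at `29` (`29 ∣ Δ`, `29 ∤ c₄`), so `ord_29 j < 0` and `j` is not a CM invariant. [cite: SilvermanAEC2009, App. C §11] -/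
theorem not_hasCM_464D1 :
    haveI := isElliptic_464D1
    ¬ (⟨0, -1, 0, -4, -4⟩ : WeierstrassCurve ℚ).HasCM := by
  haveI : Fact (Nat.Prime 2) := ⟨Nat.prime_two⟩
  haveI := isElliptic_464D1; haveI := isGloballyMinimal_464D1
  haveI : Fact (Nat.Prime 29) := ⟨by norm_num⟩
  exact AdditivePotMult.not_hasCM_of_padicValRat_j_neg (p := 29) (EisensteinPrimes.padicValRat_j_neg_of_mult _ 29
    (hasMultiplicativeReductionAtPrime_of_intModel intModel_464D1 29 (by rw [M464D1_Δ]; decide) (by rw [M464D1_c₄]; decide)))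

/-- **THE ZHAI-1.1 ROAD AT THE BASE `464D1`**: for every `M` as in Zhai 2016 Thm. 1.1 (square-free,
`M ≡ 1 (mod 4)`, `(M, N) = 1`, `r ≥ 1` odd prime factors all inert in the cubic `2`-division field `F` of `464D1`) and every global
minimal `W ≅ 464D1^{(M)}`: `r_an(W) = 0`, `W` is ADDITIVE and POTENTIALLY GOOD at `2`, NON-CM, `W[2]` IRREDUCIBLE, and the LOWER
half `MissingLowerBoundAt W 2` of BSD₂ HOLDS. KERNEL: ellipticity, global minimality, `Δ < 0`, `E[2]` irreducible,
`ord₂ j = 4`, non-CM. DISPLAYED (as printed): the `X₀(464)`-optimality datum (`Dt`, `hopt`) and the record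
`ord₂(L(464D1,1)/Ω_∞) = 0` (Cremona 1992 Tables 1 and 4: L(E,1)/Ω_BSD = S·∏c_p/#T² = 1 (Δ < 0, one real component, Ω_BSD = Ω_∞): ord₂ L^alg = 0); the odd Manin constant of Zhai's corrected statement is
Agashe–Ribet–Stein Thm. 2.6 BY NAME (`h26`) at level `N ≤ 130000` (kernel `conductorNorm_le_464D1`). Inputs BY NAME: Zhai 2016
Thm. 1.1 (corrected, arXiv v2), Agashe–Ribet–Stein 2006 Thm. 2.6, modularity. No GZK, no reading, no instrument, no base
certificate. BSD is not proved by any of this.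
[cite: Zhai2016, Thm. 1.1] [cite: AgasheRibetStein2006, Thm. 2.6] [cite: CremonaAlgorithms1997, Table 1 and Table 4] [cite: Miller2011LMS, Def. 1.1] -/
theorem printFamily464D1_lower (h11 : thm11_ordTwo_LAlg_twist_eq_zero')
    (h26 : cremona_abs_maninConstant_eq_one_of_level_le) (hmod : hasEntireLFunction_rat)
    [hN : haveI := isElliptic_464D1; NeZero ((⟨0, -1, 0, -4, -4⟩ : WeierstrassCurve ℚ).conductorNorm ℤ)]
    (Dt : haveI := isElliptic_464D1; ModularParametrizationData (⟨0, -1, 0, -4, -4⟩ : WeierstrassCurve ℚ) ((⟨0, -1, 0, -4, -4⟩ : WeierstrassCurve ℚ).conductorNorm ℤ))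
    (hopt : haveI := isElliptic_464D1; Zhai2021.IsOptimalDatum (⟨0, -1, 0, -4, -4⟩ : WeierstrassCurve ℚ) Dt)
    (hL : haveI := isElliptic_464D1; ∃ x : ℚ, IsLAlg (⟨0, -1, 0, -4, -4⟩ : WeierstrassCurve ℚ) x ∧ x ≠ 0 ∧ padicValRat 2 x = 0)
    (F : Type) [Field F] [NumberField F] (hF : IsTwoDivisionField (⟨0, -1, 0, -4, -4⟩ : WeierstrassCurve ℚ) F)
    (M : ℤ) (hsq : Squarefree M) (hM4 : M % 4 = 1)
    (hgcd : haveI := isElliptic_464D1; Int.gcd M ((⟨0, -1, 0, -4, -4⟩ : WeierstrassCurve ℚ).conductorNorm ℤ) = 1)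
    (hne : M.natAbs.primeFactors.Nonempty) (hin : ∀ q ∈ M.natAbs.primeFactors, q ≠ 2 ∧ IsInertIn F q)
    (W : WeierstrassCurve ℚ) [W.IsElliptic] [W.IsGloballyMinimal]
    (hW : ∃ C : VariableChange ℚ, C • (⟨0, -1, 0, -4, -4⟩ : WeierstrassCurve ℚ).quadraticTwist (M : ℚ) = W) :
    haveI : Fact (Nat.Prime 2) := ⟨Nat.prime_two⟩
    W.analyticRank = 0 ∧ Addv W 2 ∧ 0 ≤ padicValRat 2 W.j ∧ ¬ W.HasCM ∧ Irr W 2 ∧ MissingLowerBoundAt W 2 := by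
  haveI := isElliptic_464D1; haveI := isGloballyMinimal_464D1
  exact printFamilyZhai11'_lower_of_level_le h11 h26 hmod _ conductorNorm_le_464D1 Dt hopt Δ_sign_464D1 irr_two_464D1
    (by rw [padicValRat_j_464D1]; norm_num) (by rw [padicValRat_j_464D1]; norm_num) not_hasCM_464D1 hL F hF M hsq hM4
    hgcd hne hin W hW

end Base464D1

end Summit.BirchSwinnertonDyer.BirchSwinnertonDyer.Theorems.AddPotGoodPrint

end
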